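import Summits.QuantumFields.YangMills.Theorems.BalabanUVNodesN21HistoriesRStepOnOff

/-!
# N21 histories road, module 20o′ — GUARD for module 20o's (Eon) regrouping: the constant is ATTAINED, and `hdown` BITES

Track A of `YM-PLAN.md` (cell `pub-ymgap`, HUMAN RULING D-0062), node **N21** (NE7c); R134 ACCELERATION SEAT `pub-ymgap-dag-n21-d` (s2), generation 6, module 20o′ —
the §-guard companion of module 20o `…N21HistoriesRStepOnOff` (lens ROW A⁹, `sum_on_le_mul_sum_off`), in the style of this lineage's guards 20d (transport) and
20i §1 (model A).  Two facts a referee asks of a hypothesis-shaped inequality (A2 ∕ A3 of the cell's discharge checklist):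
* §1 SHARPNESS — `sum_on_eq_mul_sum_off_powerset`: on the FULL power set of a finite component universe `U ⊇ near` with PRODUCT weights `r S = Π_{C∈S} q_C`
  (exact conditional independence), the ON sum EQUALS `(Π_{C∈near}(1+q_C) − 1) ×` the OFF sum — so 20o's constant `Σ_{∅≠N⊆near} ρ N` with `ρ N = Π_{C∈N} q_C`
  (20o `sum_nonempty_powerset_prod_eq`) is attained: the regrouping loses NOTHING beyond the one-sided conditional bound `hcond`.
* §2 `hdown` IS LOAD-BEARING — `not_sum_on_le_mul_sum_off_without_hdown`: the one-element family `Adm = {{⋆}}`, `near = {⋆}`, `r ≡ 1` satisfies every hypothesis of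
  `sum_on_le_mul_sum_off` except downward closure (`∅ ∉ Adm`), `hcond` included (with `ρ ≡ 1`), and its ON sum `1` is NOT bounded by ANY constant times its OFF
  sum `0`.  (In print the receiving term itself — nothing restored — is always admissible: [IV] p.176 (0.3)'s sum includes `a = a′`; def-R `rstepOfSel`.)

HONEST FRAMING: [folklore] toy bookkeeping on `Finset.powerset`; nothing of Bałaban's is asserted or used; NE7c is NOT PRINTED and NOT proved; N21 is NOT discharged;
the discharged count of record (5∕27, A-count 5∕28) is UNMOVED; COUNT-NEUTRAL; 0 `sorry`, standard axioms.  Lane: `--supports` the K3⁗ item `SpineGivenEndpointR13Sep`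
(stmt-QuantumFields-20292) `--as helper`.  Imports module 20o only.
-/

set_option autoImplicit false

open scoped BigOperators

namespace Summit.QuantumFields.YangMills.Theorems.N21HistoriesRStepOnOffSanity

open Summit.QuantumFields.YangMills.Theorems.N21HistoriesRStepOnOff (sum_on_le_mul_sum_off sum_nonempty_powerset_prod_eq cond_of_prod)

/-! ## §1 SHARPNESS: product weights on a full power set attain the constant -/
section Sharp

variable {κ : Type*} [DecidableEq κ]

/-- On the power set of `U`, the sets missing `near` are exactly the power set of `U ∖ near`. [folklore] -/
theorem filter_powerset_inter_eq_empty (U near : Finset κ) :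
    U.powerset.filter (fun S => S ∩ near = ∅) = (U \ near).powerset := by
  ext S
  simp only [Finset.mem_filter, Finset.mem_powerset, Finset.subset_sdiff, ← Finset.disjoint_iff_inter_eq_empty]

/-- The OFF sum of product weights over a full power set is `Π_{C ∈ U ∖ near} (1 + q_C)`. [folklore] -/
theorem sum_off_prod_powerset (U near : Finset κ) (q : κ → ℝ) :
    ∑ S ∈ U.powerset.filter (fun S => S ∩ near = ∅), ∏ C ∈ S, q C = ∏ C ∈ U \ near, (1 + q C) := by
  rw [filter_powerset_inter_eq_empty, Finset.prod_one_add]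

/-- The ON sum of product weights over a full power set is `(Π_{C∈near}(1+q_C) − 1) · Π_{C ∈ U ∖ near}(1 + q_C)` when `near ⊆ U`. [folklore] -/
theorem sum_on_prod_powerset (U near : Finset κ) (hU : near ⊆ U) (q : κ → ℝ) :
    ∑ S ∈ U.powerset.filter (fun S => (S ∩ near).Nonempty), ∏ C ∈ S, q C =
      (∏ C ∈ near, (1 + q C) - 1) * ∏ C ∈ U \ near, (1 + q C) := by
  have htot : ∑ S ∈ U.powerset, ∏ C ∈ S, q C = ∏ C ∈ U, (1 + q C) := (Finset.prod_one_add _).symm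
  have hsplit := Finset.sum_filter_add_sum_filter_not U.powerset (fun S => (S ∩ near).Nonempty) (fun S => ∏ C ∈ S, q C)
  have hnot : U.powerset.filter (fun S => ¬ (S ∩ near).Nonempty) = U.powerset.filter (fun S => S ∩ near = ∅) :=
    Finset.filter_congr fun S _ => Finset.not_nonempty_iff_eq_empty
  rw [hnot, sum_off_prod_powerset, htot, ← Finset.prod_sdiff hU] at hsplit
  linarith

/-- **SHARPNESS of module 20o's `sum_on_le_mul_sum_off`.**  Full power set of `U ⊇ near`, product weights: the ON sum EQUALS `(Π_{C∈near}(1+q_C) − 1) ×` the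
OFF sum, i.e. 20o's bound with `ρ N = Π_{C∈N} q_C` (whose constant is `Π(1+q) − 1` by 20o's `sum_nonempty_powerset_prod_eq`) holds with EQUALITY. [folklore] -/
theorem sum_on_eq_mul_sum_off_powerset (U near : Finset κ) (hU : near ⊆ U) (q : κ → ℝ) :
    ∑ S ∈ U.powerset.filter (fun S => (S ∩ near).Nonempty), ∏ C ∈ S, q C =
      (∑ N ∈ near.powerset.filter (fun N => N.Nonempty), ∏ C ∈ N, q C) *
        ∑ S ∈ U.powerset.filter (fun S => S ∩ near = ∅), ∏ C ∈ S, q C := by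
  rw [sum_on_prod_powerset U near hU, sum_nonempty_powerset_prod_eq, sum_off_prod_powerset]

/-- … and 20o's inequality at these data is an instance (consistency check BY NAME: the guard's equality is not weaker than the module's bound). [folklore] -/
theorem sum_on_le_mul_sum_off_powerset (U near : Finset κ) (q : κ → ℝ) (hq : ∀ C, 0 ≤ q C) :
    ∑ S ∈ U.powerset.filter (fun S => (S ∩ near).Nonempty), ∏ C ∈ S, q C ≤
      (∑ N ∈ near.powerset.filter (fun N => N.Nonempty), ∏ C ∈ N, q C) *
        ∑ S ∈ U.powerset.filter (fun S => S ∩ near = ∅), ∏ C ∈ S, q C :=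
  sum_on_le_mul_sum_off U.powerset near (fun S => ∏ C ∈ S, q C) (fun N => ∏ C ∈ N, q C)
    (fun _ hS _ hS' => Finset.mem_powerset.2 (hS'.trans (Finset.mem_powerset.1 hS)))
    (fun _ _ => Finset.prod_nonneg fun C _ => hq C) (fun _ _ => Finset.prod_nonneg fun C _ => hq C)
    (fun S _ _ => cond_of_prod near q q hq (fun _ _ => le_rfl) S)

end Sharp

/-! ## §2 `hdown` BITES: without downward closure no constant works -/
section Down

/-- The one-element family `{{⋆}}` over `Unit`: its ON sum (for `near = {⋆}`, `r ≡ 1`) is `1` … [folklore] -/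
theorem toy_sum_on :
    ∑ S ∈ ({({()} : Finset Unit)} : Finset (Finset Unit)).filter (fun S => (S ∩ {()}).Nonempty), (1 : Finset Unit → ℝ) S = 1 := by
  rw [Finset.filter_true_of_mem fun _ hS => by rw [Finset.mem_singleton.1 hS]; simp, Finset.sum_singleton, Pi.one_apply]

/-- … and its OFF sum is `0` (the empty restoration is NOT in the family). [folklore] -/
theorem toy_sum_off :
    ∑ S ∈ ({({()} : Finset Unit)} : Finset (Finset Unit)).filter (fun S => S ∩ {()} = ∅), (1 : Finset Unit → ℝ) S = 0 := by
  rw [Finset.filter_false_of_mem fun _ hS => by rw [Finset.mem_singleton.1 hS]; simp, Finset.sum_empty]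

/-- The toy satisfies `hcond` with `ρ ≡ 1` (indeed every hypothesis of 20o's `sum_on_le_mul_sum_off` except `hdown`). [folklore] -/
theorem toy_hcond : ∀ S ∈ ({({()} : Finset Unit)} : Finset (Finset Unit)), (S ∩ {()}).Nonempty →
    (1 : Finset Unit → ℝ) S ≤ (1 : Finset Unit → ℝ) (S ∩ {()}) * (1 : Finset Unit → ℝ) (S \ {()}) := by
  intro _ _ _; simp

/-- The toy's weights are nonnegative (`hr` of 20o). [folklore] -/
theorem toy_hr : ∀ S ∈ ({({()} : Finset Unit)} : Finset (Finset Unit)), 0 ≤ (1 : Finset Unit → ℝ) S := by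
  intro _ _; simp

/-- The toy is NOT downward closed: `∅ ⊆ {⋆}` but `∅ ∉ {{⋆}}`. [folklore] -/
theorem toy_not_hdown : ¬ ∀ S ∈ ({({()} : Finset Unit)} : Finset (Finset Unit)), ∀ S', S' ⊆ S →
    S' ∈ ({({()} : Finset Unit)} : Finset (Finset Unit)) := by
  intro h
  have := h {()} (Finset.mem_singleton_self _) ∅ (Finset.empty_subset _)
  simp at this

/-- **`hdown` IS LOAD-BEARING in module 20o's `sum_on_le_mul_sum_off`**: for the toy family (nonnegative weights, `hcond` with `ρ ≡ 1`, NOT downward closed)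
the ON sum is not bounded by ANY constant times the OFF sum. [folklore] -/
theorem not_sum_on_le_mul_sum_off_without_hdown (c : ℝ) :
    ¬ ∑ S ∈ ({({()} : Finset Unit)} : Finset (Finset Unit)).filter (fun S => (S ∩ {()}).Nonempty), (1 : Finset Unit → ℝ) S ≤
        c * ∑ S ∈ ({({()} : Finset Unit)} : Finset (Finset Unit)).filter (fun S => S ∩ {()} = ∅), (1 : Finset Unit → ℝ) S := by
  rw [toy_sum_on, toy_sum_off, mul_zero]
  norm_num

end Down

end Summit.QuantumFields.YangMills.Theorems.N21HistoriesRStepOnOffSanity
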